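import Summits.NavierStokesRegularity.NavierStokesRegularity.Theorems.ExtremiserTransienceNearExtremalTransienceSharpForm
import HarnessLib.Audit

/-!
# Skeleton of the crux `ExtremiserTransience.NearExtremalTransience` — line `intrinsic_flyby` (v1)
(crux item `stmt-NavierStokesRegularity-21883`; D-0145 ideator seat `ns-idea-10` g0, lens «rescuer», 2026-08-28.)

THE RECORDED DEATH this line dodges. The registered line `Lines/birth.lean` (v4) has ONE stub `stub_sharpLogMean`
EQUIVALENT to the crux: «at the present state of knowledge the crux is atomic» (`Lines/birth.md`: a proof needs (M1) the
structure of near-maximisers of the efficiency `R` and (M2) an exit estimate for the Leray-similarity flow, uniform over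
all Type-I singular flows, with (M3) no compactness of the flow class to bootstrap uniformity from). Diagnosis: every
attempt kept the crux's LETTER — a GLOBAL log-time quadratic mean of `R(t) = k₀(t)` in the ENVELOPE clock `dt/(T−t)`
(Leray-similarity time) — and asked a mechanism to deliver that letter. But the transience mechanism («extreme vortex
states are not sustained», Lu–Doering / Ayala–Protas) lives in the flow's OWN clock (eddy-turnover, or the intrinsic
`sup|u|²dt/ν`), which differs from the envelope clock by a factor `b(t)` (e.g. the squared Leray amplitude
`sup|u(t)|²(T−t)/ν ∈ [c², C²]`) that is NOT universal — a global clock comparison only gives `θ = θ(C)`, useless.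

THE DODGE (two explicit, non-equivalent cruxes + kernel-checked glue).
(1) `stub_flybySparseClock` — the MECHANISM, local in time: every Type-I singular classical Leray–Hopf
rapidly-decaying-datum flow carries, from some onset, an ADMISSIBLE CLOCK `w(t)dt` — `c ≤ (T−t)·w(t) ≤ C'` (the lower
constant universal, the upper one per flow) whose rate at most doubles within `c₀` of its own units — in which the
near-extremal times (`k₀ ≥ κ⋆ − δ`) are BURST-SPARSE: any two of them are `≤ η` apart or `≥ g` apart (`2η < g`), with
`δ, η, g, c₀, c` UNIVERSAL. Candidate clocks: the eddy-turnover clock (Hölder `C^{1,α}` local theory, uniform in `ν`,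
gives the doubling control and `c ≤ (T−t)w`; Type-I parabolic regularity gives `(T−t)w ≤ C'`), or the intrinsic clock
`w = sup|u|²/ν` (doubling control = `Literature…exists_norm_le_two_mul_of_window` + last crossing; lower bound = Leray's
rate `leray_blowup_rate_top_holds`). Content = Morse–Bott flyby: compactness of near-maximisers of `R` modulo
symmetries, non-degenerate maximum, transversality of the (Euler + (1/Re)·Stokes) vector field to the extremal set,
uniformly on the compactified parameter range — near-extremal episodes last `≤ η` turnovers and re-forming one costs `≥ g`.
(2) `stub_clockExchange` — pure real analysis, TRUE (proof in `Lines/intrinsic_flyby.md`): burst-sparsity in ANY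
admissible clock ⟹ the ENVELOPE density of the near-extremal set is `≤ λ/(1+λ)`, `λ = 2^(⌈η/c₀⌉+1)·η/min(c₀,g)`, because
`dt/(T−t) = w dt/b` and the factor `b = (T−t)w` CANCELS in the ratio envelope(burst hull) : envelope(following gap) —
both are controlled from the burst's END by the doubling bound; the `t`-cut last burst costs `≤ 2^m η/c`. Hence
`∫_(t₁)^t k₀²/(T−τ) ≤ (κ⋆² − (2κ⋆δ − δ²)/(1+λ))·log((T−t₁)/(T−t)) + B`: a universal `θ < 1`, for every `K' ≥ κ⋆`.
(3) `coefLeSharp` (PROVED here): the minimal coefficient is `≤ κ⋆` (`κ⋆ ∈ V` + admissible slices + minimality).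
The composition `NearExtremalTransience_of` is a real proof (`DepletionLadder.exists_canonical_coefficient`,
`DepletionLadder.sharpDepletion_le`, `DepletionLadder.sharpDepletion_gt`). Nothing here proves Navier–Stokes regularity;
the open content is `stub_flybySparseClock` (research-level, but LOCAL: a recurrence statement checkable per flow on
finite windows, falsifiable by one DNS run from a near-maximiser of `R`) — the crux is no longer atomic.
-/

noncomputable section

open Set MeasureTheory Filter Topology
open scoped InnerProductSpace RealInnerProductSpace ENNReal
open Literature.Analysis.FluidPDE

namespace Summit.NavierStokesRegularity.NavierStokesRegularity.Cruxes.NearExtremalTransience.IntrinsicFlyby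

open Summit.NavierStokesRegularity.NavierStokesRegularity.Theses.ExtremiserTransience
open Summit.NavierStokesRegularity.NavierStokesRegularity.Theorems
open Summit.NavierStokesRegularity.NavierStokesRegularity.Theorems.DepletionLadder

set_option linter.unusedVariables false
set_option linter.dupNamespace false

/-- **stub (MECHANISM, rank 2, XL — the new explicit crux).** FLYBY SPARSITY IN AN ADMISSIBLE CLOCK: universal
`δ ∈ (0, κ⋆)`, `η > 0`, `g > 2η`, `c₀, c > 0` such that every Type-I singular classical Leray–Hopf rapidly-decaying-datum flow
on `[0,T)`, with minimal flow-wise coefficient `k₀`, admits from some onset `t₁` a measurable clock rate `w ≥ 0` with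
`c ≤ (T−t)w(t) ≤ C'` on `[t₁,T)`, doubling control `∫_s^t w ≤ c₀ ⇒ w(t) ≤ 2w(s)`, in which any two near-extremal times
`s ≤ t` (`k₀ ≥ κ⋆ − δ` at both) satisfy `∫_s^t w ≤ η ∨ ∫_s^t w ≥ g`. Why it might fail: lingering near the extremal set
(an Euler/NS-invariant near-extremal family; loss of compactness of maximising sequences of `R`, so «near-extremal» is
not a tube around a compact set and exit times are not uniform), fast chaotic re-entry (gaps `< g`), or no admissible
clock with UNIVERSAL burst constants (the intrinsic clock sees bursts of length ~ local Reynolds number; the eddy clock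
needs Hölder-class growth control). [sources: arXiv:1605.05742 (p.2, p.5), arXiv:1909.00041 (p.13, p.20), LuDoering2008,
Lines/birth.md §M1–M3] -/
theorem stub_flybySparseClock :
    ∃ δ η g c₀ c : ℝ, 0 < δ ∧ δ < sInf {κ : ℝ | (∀ (v : EuclideanSpace ℝ (Fin 3) → EuclideanSpace ℝ (Fin 3)) (M B : ℝ), ContDiff ℝ (⊤ : ℕ∞) v → Literature.Analysis.FluidPDE.VectorCalculus.IsDivFree v → (∀ x, ‖v x‖ ≤ M) → (∀ x, ‖fderiv ℝ v x‖ ≤ B) → (∫⁻ x, ‖iteratedFDeriv ℝ 0 v x‖ₑ ^ 2 < ⊤) → (∫⁻ x, ‖iteratedFDeriv ℝ 1 v x‖ₑ ^ 2 < ⊤) → (∫⁻ x, ‖iteratedFDeriv ℝ 2 v x‖ₑ ^ 2 < ⊤) → |∫ x, ⟪curl v x, fderiv ℝ v x (curl v x)⟫_ℝ| ≤ κ * M * Real.sqrt (∫ x, ‖curl v x‖ ^ 2) * Real.sqrt (∫ x, frobeniusNormSq (fderiv ℝ (curl v) x)))} ∧ 0 < η ∧ 2 * η < g ∧ 0 <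 c₀ ∧ 0 < c ∧ ∀ (C ν T : ℝ), 0 < C → 0 < ν → 0 < T → ∀ (u : ℝ → EuclideanSpace ℝ (Fin 3) → EuclideanSpace ℝ (Fin 3)) (p : ℝ → EuclideanSpace ℝ (Fin 3) → ℝ), IsClassicalNSSolutionOn (Set.Ico 0 T) ν 0 u p → IsLerayHopfOn T ν 0 (u 0) u → HasRapidSpatialDecay (u 0) → (∀ᶠ t in 𝓝[<] T, ∀ x, Real.sqrt (T - t) * ‖u t x‖ ≤ C * Real.sqrt ν) → ¬ HasSmoothExtensionPast ν 0 u T → ∀ (k₀ : ℝ → ℝ), Measurable k₀ → (∀ τ, 0 ≤ k₀ τ ∧ k₀ τ ≤ 1) → (∀ t ∈ Set.Ico 0 T, ∀ M : ℝ, (∀ x, ‖u t x‖ ≤ M) → |∫ x, ⟪curl (u t) x, fderiv ℝ (u t) x (curl (u t) x)⟫_ℝ| ≤ k₀ t * M * Real.sqrt (∫ x, ‖curl (u t) x‖ ^ 2) * Real.sqrt (∫ x, frobeniusNormSq (fderiv ℝ (curl (u t)) x))) → (∀ t ∈ Set.Ico 0 T, ∀ c : ℝ, 0 ≤ c → (∀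 M : ℝ, (∀ x, ‖u t x‖ ≤ M) → |∫ x, ⟪curl (u t) x, fderiv ℝ (u t) x (curl (u t) x)⟫_ℝ| ≤ c * M * Real.sqrt (∫ x, ‖curl (u t) x‖ ^ 2) * Real.sqrt (∫ x, frobeniusNormSq (fderiv ℝ (curl (u t)) x))) → k₀ t ≤ c) → ∃ t₁ ∈ Set.Ico 0 T, ∃ (w : ℝ → ℝ) (C' : ℝ), Measurable w ∧ (∀ t, 0 ≤ w t) ∧ (∀ t ∈ Set.Ico t₁ T, c ≤ (T - t) * w t ∧ (T - t) * w t ≤ C') ∧ (∀ s ∈ Set.Ico t₁ T, ∀ t ∈ Set.Ico t₁ T, s ≤ t → ∫ τ in s..t, w τ ≤ c₀ → w t ≤ 2 * w s) ∧ (∀ s ∈ Set.Ico t₁ T, ∀ t ∈ Set.Ico t₁ T, s ≤ t → sInf {κ : ℝ | (∀ (v : EuclideanSpace ℝ (Fin 3) → EuclideanSpace ℝ (Fin 3)) (M B : ℝ), ContDiff ℝ (⊤ : ℕ∞) v → Literature.Analysis.FluidPDE.VectorCalculus.IsDivFree v → (∀ x, ‖v x‖ ≤ M) → (∀ x, ‖fderiv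 ℝ v x‖ ≤ B) → (∫⁻ x, ‖iteratedFDeriv ℝ 0 v x‖ₑ ^ 2 < ⊤) → (∫⁻ x, ‖iteratedFDeriv ℝ 1 v x‖ₑ ^ 2 < ⊤) → (∫⁻ x, ‖iteratedFDeriv ℝ 2 v x‖ₑ ^ 2 < ⊤) → |∫ x, ⟪curl v x, fderiv ℝ v x (curl v x)⟫_ℝ| ≤ κ * M * Real.sqrt (∫ x, ‖curl v x‖ ^ 2) * Real.sqrt (∫ x, frobeniusNormSq (fderiv ℝ (curl v) x)))} - δ ≤ k₀ s → sInf {κ : ℝ | (∀ (v : EuclideanSpace ℝ (Fin 3) → EuclideanSpace ℝ (Fin 3)) (M B : ℝ), ContDiff ℝ (⊤ : ℕ∞) v → Literature.Analysis.FluidPDE.VectorCalculus.IsDivFree v → (∀ x, ‖v x‖ ≤ M) → (∀ x, ‖fderiv ℝ v x‖ ≤ B) → (∫⁻ x, ‖iteratedFDeriv ℝ 0 v x‖ₑ ^ 2 < ⊤) → (∫⁻ x, ‖iteratedFDeriv ℝ 1 v x‖ₑ ^ 2 < ⊤) → (∫⁻ x, ‖iteratedFDeriv ℝ 2 v x‖ₑ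 ^ 2 < ⊤) → |∫ x, ⟪curl v x, fderiv ℝ v x (curl v x)⟫_ℝ| ≤ κ * M * Real.sqrt (∫ x, ‖curl v x‖ ^ 2) * Real.sqrt (∫ x, frobeniusNormSq (fderiv ℝ (curl v) x)))} - δ ≤ k₀ t → (∫ τ in s..t, w τ ≤ η ∨ g ≤ ∫ τ in s..t, w τ)) := by
  sorry

/-- **stub (support, L — pure real analysis, no Navier–Stokes; TRUE).** CLOCK EXCHANGE: for `0 < δ < K`, `0 < η`,
`2η < g`, `c₀, c > 0` there is `θ = θ(K,δ,η,g,c₀,c) ∈ [0,1)` such that: whenever `0 ≤ k₀ ≤ K` on `[t₁,T)`, `w ≥ 0` is a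
clock with `c ≤ (T−t)w ≤ C'`, doubling control in its own units, and the times `{k₀ ≥ K−δ}` are `(η,g)`-burst-sparse in
the `w`-clock, then `∫_(t₁)^t k₀²/(T−τ) ≤ (θK')² log((T−t₁)/(T−t)) + B` for every `K' ≥ K` (with `B` depending on the
data, `θ` not — in particular not on `C'`). Proof: `dt/(T−t) = w dt/b`, `b = (T−t)w`; a burst hull `H` (w-length `≤ η`)
has envelope measure `≤ 2^m η/b_e` (`m = ⌈η/c₀⌉`, `b_e = b` at the hull's end) and the following gap (w-length `≥ g`)
has envelope measure `≥ min(c₀,g)/(2b_e)`; the `t`-cut last hull costs `≤ 2^m η/c`; so the envelope density of the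
near set is `≤ λ/(1+λ)` up to an additive constant, and `θ² = 1 − (2δ/K − δ²/K²)/(1+λ)`. -/
theorem stub_clockExchange :
    ∀ (K δ η g c₀ c : ℝ), 0 < K → 0 < δ → δ < K → 0 < η → 2 * η < g → 0 < c₀ → 0 < c → ∃ θ : ℝ, 0 ≤ θ ∧ θ < 1 ∧ ∀ (T t₁ C' : ℝ) (k₀ w : ℝ → ℝ), t₁ < T → Measurable k₀ → Measurable w → (∀ τ, 0 ≤ k₀ τ) → (∀ τ ∈ Set.Ico t₁ T, k₀ τ ≤ K) → (∀ t, 0 ≤ w t) → (∀ t ∈ Set.Ico t₁ T, c ≤ (T - t) * w t ∧ (T - t) * w t ≤ C') → (∀ s ∈ Set.Ico t₁ T, ∀ t ∈ Set.Ico t₁ T, s ≤ t → ∫ τ in s..t, w τ ≤ c₀ → w t ≤ 2 * w s) → (∀ s ∈ Set.Ico t₁ T, ∀ t ∈ Set.Ico t₁ T, s ≤ t → K - δ ≤ k₀ s → K - δ ≤ k₀ t → (∫ τ in s..t, w τ ≤ η ∨ g ≤ ∫ τ in s..t, w τ)) → ∀ K' : ℝ, K ≤ K' → ∃ B : ℝ,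 ∀ t ∈ Set.Ico t₁ T, ∫ τ in t₁..t, k₀ τ ^ 2 / (T - τ) ≤ (θ * K') ^ 2 * Real.log ((T - t₁) / (T - t)) + B := by
  sorry

/-- **support (PROVED here).** The minimal flow-wise coefficient never exceeds the sharp static constant `κ⋆`:
`κ⋆ ∈ V` (`DepletionLadder.sharpDepletion_is_universal`), the slices are admissible
(`DepletionLadder.flowwise_of_universal`), and `k₀` is minimal. -/
theorem coefLeSharp :
    ∀ (ν T : ℝ), 0 < ν → 0 < T → ∀ (u : ℝ → EuclideanSpace ℝ (Fin 3) → EuclideanSpace ℝ (Fin 3)) (p : ℝ → EuclideanSpace ℝ (Fin 3) → ℝ), IsClassicalNSSolutionOn (Set.Ico 0 T) ν 0 u p → IsLerayHopfOn T ν 0 (u 0) u → HasRapidSpatialDecay (u 0) → ∀ (k₀ : ℝ → ℝ), Measurable k₀ → (∀ τ, 0 ≤ k₀ τ ∧ k₀ τ ≤ 1) → (∀ t ∈ Set.Ico 0 T, ∀ M : ℝ, (∀ x, ‖u t x‖ ≤ M) → |∫ x, ⟪curl (u t) x, fderiv ℝ (u t) x (curl (u t) x)⟫_ℝ| ≤ k₀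 t * M * Real.sqrt (∫ x, ‖curl (u t) x‖ ^ 2) * Real.sqrt (∫ x, frobeniusNormSq (fderiv ℝ (curl (u t)) x))) → (∀ t ∈ Set.Ico 0 T, ∀ c : ℝ, 0 ≤ c → (∀ M : ℝ, (∀ x, ‖u t x‖ ≤ M) → |∫ x, ⟪curl (u t) x, fderiv ℝ (u t) x (curl (u t) x)⟫_ℝ| ≤ c * M * Real.sqrt (∫ x, ‖curl (u t) x‖ ^ 2) * Real.sqrt (∫ x, frobeniusNormSq (fderiv ℝ (curl (u t)) x))) → k₀ t ≤ c) → ∀ t ∈ Set.Ico 0 T, k₀ t ≤ sInf {κ : ℝ | (∀ (v : EuclideanSpace ℝ (Fin 3) → EuclideanSpace ℝ (Fin 3)) (M B : ℝ), ContDiff ℝ (⊤ : ℕ∞) v → Literature.Analysis.FluidPDE.VectorCalculus.IsDivFree v → (∀ x, ‖v x‖ ≤ M) → (∀ x, ‖fderiv ℝ v x‖ ≤ B) → (∫⁻ x, ‖iteratedFDeriv ℝ 0 v x‖ₑ ^ 2 < ⊤) → (∫⁻ x, ‖iteratedFDeriv ℝ 1 v x‖ₑ ^ 2 < ⊤) →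 (∫⁻ x, ‖iteratedFDeriv ℝ 2 v x‖ₑ ^ 2 < ⊤) → |∫ x, ⟪curl v x, fderiv ℝ v x (curl v x)⟫_ℝ| ≤ κ * M * Real.sqrt (∫ x, ‖curl v x‖ ^ 2) * Real.sqrt (∫ x, frobeniusNormSq (fderiv ℝ (curl v) x)))} := by
  intro ν T hν hT u p hsol hLH hdec k₀ hk₀m hk₀01 hcoef hmin t ht
  have hKpos : (0:ℝ) < sInf {κ : ℝ | (∀ (v : EuclideanSpace ℝ (Fin 3) → EuclideanSpace ℝ (Fin 3)) (M B : ℝ), ContDiff ℝ (⊤ : ℕ∞) v → Literature.Analysis.FluidPDE.VectorCalculus.IsDivFree v → (∀ x, ‖v x‖ ≤ M) → (∀ x, ‖fderiv ℝ v x‖ ≤ B) → (∫⁻ x, ‖iteratedFDeriv ℝ 0 v x‖ₑ ^ 2 < ⊤) → (∫⁻ x, ‖iteratedFDeriv ℝ 1 v x‖ₑ ^ 2 < ⊤) → (∫⁻ x, ‖iteratedFDeriv ℝ 2 v x‖ₑ ^ 2 < ⊤) → |∫ x, ⟪curl v x, fderiv ℝ v x (curl v x)⟫_ℝ| ≤ κ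 * M * Real.sqrt (∫ x, ‖curl v x‖ ^ 2) * Real.sqrt (∫ x, frobeniusNormSq (fderiv ℝ (curl v) x)))} :=
    lt_trans (by norm_num) sharpDepletion_gt
  exact hmin t ht _ hKpos.le (flowwise_of_universal sharpDepletion_is_universal hν hT hsol hLH hdec t ht)

/-- **Composition (real proof).** The two stubs (+ the proved `coefLeSharp`) imply the crux `NearExtremalTransience`
BY NAME: the canonical coefficient `k₀` of the flow, the clock and onset of `stub_flybySparseClock`, the universal `θ`
of `stub_clockExchange` at `K = κ⋆`, and `κ⋆ ≤ κ` for the given universal `κ`. -/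
theorem NearExtremalTransience_of : NearExtremalTransience := by
  obtain ⟨δ, η, g, c₀, c, hδ, hδK, hη, hηg, hc₀, hc, hS⟩ := stub_flybySparseClock
  have hKpos : (0:ℝ) < sInf {κ : ℝ | (∀ (v : EuclideanSpace ℝ (Fin 3) → EuclideanSpace ℝ (Fin 3)) (M B : ℝ), ContDiff ℝ (⊤ : ℕ∞) v → Literature.Analysis.FluidPDE.VectorCalculus.IsDivFree v → (∀ x, ‖v x‖ ≤ M) → (∀ x, ‖fderiv ℝ v x‖ ≤ B) → (∫⁻ x, ‖iteratedFDeriv ℝ 0 v x‖ₑ ^ 2 < ⊤) → (∫⁻ x, ‖iteratedFDeriv ℝ 1 v x‖ₑ ^ 2 < ⊤) → (∫⁻ x, ‖iteratedFDeriv ℝ 2 v x‖ₑ ^ 2 < ⊤) → |∫ x, ⟪curl v x, fderiv ℝ v x (curl v x)⟫_ℝ| ≤ κ * M * Real.sqrt (∫ x, ‖curl v x‖ ^ 2) * Real.sqrt (∫ x, frobeniusNormSq (fderiv ℝ (curl v) x)))} :=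
    lt_trans (by norm_num) sharpDepletion_gt
  obtain ⟨θ, hθ0, hθ1, hX⟩ := stub_clockExchange _ δ η g c₀ c hKpos hδ hδK hη hηg hc₀ hc
  refine ⟨θ, hθ0, hθ1, ?_⟩
  intro κ hκ C ν T hC hν hT u p hsol hLH hdec hrate hext
  obtain ⟨k₀, hk₀m, hk₀01, hcoef, hmin⟩ := exists_canonical_coefficient hν hT hsol hLH hdec
  obtain ⟨t₁, ht₁, w, C', hwm, hw0, hb, hgrow, hsparse⟩ :=
    hS C ν T hC hν hT u p hsol hLH hdec hrate hext k₀ hk₀m hk₀01 hcoef hmin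
  have hsub : ∀ t ∈ Set.Ico t₁ T, t ∈ Set.Ico 0 T := fun t ht => ⟨le_trans ht₁.1 ht.1, ht.2⟩
  have hkK : ∀ τ ∈ Set.Ico t₁ T, k₀ τ ≤ sInf {κ : ℝ | (∀ (v : EuclideanSpace ℝ (Fin 3) → EuclideanSpace ℝ (Fin 3)) (M B : ℝ), ContDiff ℝ (⊤ : ℕ∞) v → Literature.Analysis.FluidPDE.VectorCalculus.IsDivFree v → (∀ x, ‖v x‖ ≤ M) → (∀ x, ‖fderiv ℝ v x‖ ≤ B) → (∫⁻ x, ‖iteratedFDeriv ℝ 0 v x‖ₑ ^ 2 < ⊤) → (∫⁻ x, ‖iteratedFDeriv ℝ 1 v x‖ₑ ^ 2 < ⊤) → (∫⁻ x, ‖iteratedFDeriv ℝ 2 v x‖ₑ ^ 2 < ⊤) → |∫ x, ⟪curl v x, fderiv ℝ v x (curl v x)⟫_ℝ| ≤ κ * M * Real.sqrt (∫ x, ‖curl v x‖ ^ 2) * Real.sqrt (∫ x, frobeniusNormSq (fderiv ℝ (curl v) x)))} :=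
    fun τ hτ => coefLeSharp ν T hν hT u p hsol hLH hdec k₀ hk₀m hk₀01 hcoef hmin τ (hsub τ hτ)
  obtain ⟨B, hB⟩ := hX T t₁ C' k₀ w ht₁.2 hk₀m hwm (fun τ => (hk₀01 τ).1) hkK hw0 hb hgrow hsparse κ
    (sharpDepletion_le hκ)
  exact ⟨t₁, ht₁, k₀, B, hk₀m, hk₀01, fun t ht M hM => hcoef t (hsub t ht) M hM, hB⟩

end Summit.NavierStokesRegularity.NavierStokesRegularity.Cruxes.NearExtremalTransience.IntrinsicFlyby

end
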